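import Literature.NumberTheory.LFunctions.MoebiusWalshTypeIICountingHigh
import Literature.NumberTheory.LFunctions.MoebiusWalshTypeIEstimate
import HarnessLib

/-!
# The high-window type-II count specialised to Bourgain's localised Walsh substitute `W_{S'}` — proved

Topic `Literature/NumberTheory/LFunctions`; proofs only (theorems, no definition, no named fact).
This short file plugs the Fourier data of the localised substitute `W_A` of a top-window Walsh
character (J. Bourgain, *Möbius–Walsh correlation bounds and an estimate of Mauduit and Rivat*,
J. Anal. Math. **119** (2013) 147–163 = arXiv:1109.2784 [Bourgain2013MoebiusWalsh], Lemma 5 and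
(2.8)–(2.10); tree `MoebiusWalsh.localisedWalsh`, `localisedCoeff`) into the abstract high-window
count `MoebiusWalsh.typeII_count_high` of `MoebiusWalshTypeIICountingHigh.lean` ((2.23)–(2.28)):

* `sum_Ico_int_norm_walshCoeff_le` — Lemma 6 on windows of INTEGER frequencies of length
  `J ≤ 4·2ⁿ`: `∑_{k ∈ [a, a+J)} |ŵ_A(k/2ⁿ)| ≤ 16 J^κ` (periodicity, the tree's Lemma 6 on at most
  four periods);
* `abs_sum_Ico_localisedWalshRe_mul_shift_le` — the Fourier expansion step (2.8)/(2.11) for the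
  differenced product `W_A(m(n+ℓ2^q)) W_A(mn)` summed over a block of `m`, with the geometric-sum
  majorant: `≤ ∑_{k,k'} |Ŵ(k)||Ŵ(k')| min(b-a, 1/(2‖((k'-k)n + k'ℓ2^q)/2^{q+σ}‖))` — the phase
  in the normal form of `typeII_count_high` (the tree's `MoebiusWalshTypeIIHigh.lean` has the same
  expansion in its own `pairPhase` normal form, `abs_sum_Ico_localisedWalshRe_mul_le`);
* `typeII_count_high_localised` — `typeII_count_high` with `c(k) = |Ŵ_A(k)|`, `F = 2K₁2^σ`,
  `A₁ = 2(q+2)2^{κσ}` (Lemma 5 (1.11) / (2.10)), `A_∞ = 2·2^{-c₂|A|}` (Lemma 2 / (2.9)),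
  `B = 16`, `κ = walshL1Exponent` (Lemma 6), under `8K₁ ≤ 2^q`.

## References

* J. Bourgain, J. Anal. Math. 119 (2013) 147–163; arXiv:1109.2784, Lemma 5, Lemma 6, §2 (2.8)–(2.12),
  (2.23)–(2.28). [Bourgain2013MoebiusWalsh]
-/

noncomputable section

open Finset Real

namespace Literature.NumberTheory.LFunctions.MoebiusWalsh

open Literature.NumberTheory.Sieve.Vinogradov (geomBound geomBound_neg geomBound_nonneg)

/-! ### Lemma 6 on integer windows -/

/-- `k ↦ |ŵ_A(k/2ⁿ)|` on `ℤ` has period `2ⁿ`. [folklore] -/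
theorem norm_walshCoeff_int_add_two_pow {n : ℕ} (A : Finset (Fin n)) (k : ℤ) :
    ‖walshCoeff A ((((k + (2 ^ n : ℕ) : ℤ)) : ℝ) / 2 ^ n)‖ = ‖walshCoeff A ((k : ℝ) / 2 ^ n)‖ := by
  rw [show (((k + (2 ^ n : ℕ) : ℤ)) : ℝ) / 2 ^ n = (k : ℝ) / 2 ^ n + ((1 : ℤ) : ℝ) by
    push_cast; field_simp, walshCoeff_add_int]

/-- **Bourgain 2013, Lemma 6, on windows of integer frequencies**: for `1 ≤ J ≤ 4·2ⁿ` and every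
`a ∈ ℤ`, `∑_{k ∈ [a, a+J)} |ŵ_A(k/2ⁿ)| ≤ 16 J^κ`, `κ = walshL1Exponent`.
[cite: Bourgain2013MoebiusWalsh, Lemma 6 (1.24)] -/
theorem sum_Ico_int_norm_walshCoeff_le {n : ℕ} (A : Finset (Fin n)) (a : ℤ) {J : ℕ} (hJ1 : 1 ≤ J)
    (hJ : J ≤ 4 * 2 ^ n) :
    ∑ k ∈ Ico a (a + J), ‖walshCoeff A ((k : ℝ) / 2 ^ n)‖ ≤ 16 * (J : ℝ) ^ walshL1Exponent := by
  set P : ℕ := 2 ^ n with hP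
  have hP0 : (0 : ℤ) < P := by rw [hP]; exact_mod_cast Nat.two_pow_pos n
  set f : ℕ → ℝ := fun j => ‖walshCoeff A ((j : ℝ) / 2 ^ n)‖ with hf
  have hf0 : ∀ j, 0 ≤ f j := fun j => norm_nonneg _
  have hfper : ∀ j, f (j + P) = f j := by
    intro j; rw [hf]; dsimp only
    rw [show (((j + P : ℕ)) : ℝ) / 2 ^ n = (j : ℝ) / 2 ^ n + ((1 : ℤ) : ℝ) by rw [hP]; push_cast; field_simp,
      walshCoeff_add_int]
  -- reduce `a` modulo `P`
  set a' : ℕ := (a % P).toNat with ha'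
  have ha'eq : ((a' : ℕ) : ℤ) = a % P := by rw [ha']; exact Int.toNat_of_nonneg (Int.emod_nonneg _ hP0.ne')
  have hdec : a = (a / P) * P + a' := by rw [ha'eq]; exact (Int.ediv_mul_add_emod a P).symm
  have hwin : ∑ k ∈ Ico a (a + J), ‖walshCoeff A ((k : ℝ) / 2 ^ n)‖ = ∑ j ∈ range J, f (a' + j) := by
    rw [sum_Ico_int_eq_sum_range]
    refine Finset.sum_congr rfl fun j _ => ?_
    rw [hf]; dsimp only
    rw [show ((a + j : ℤ) : ℝ) / 2 ^ n = (((a' + j : ℕ)) : ℝ) / 2 ^ n + (((a / P : ℤ)) : ℝ) by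
      conv_lhs => rw [hdec]
      rw [hP]; push_cast; field_simp; ring, walshCoeff_add_int]
  rw [hwin]
  have hκ0 : 0 ≤ walshL1Exponent := walshL1Exponent_pos.le
  have hIco : ∀ T : ℕ, ∑ j ∈ range T, f (a' + j) = ∑ k ∈ Ico a' (a' + T), f k := by
    intro T; rw [Finset.sum_Ico_eq_sum_range, Nat.add_sub_cancel_left]
  have hJκ : (4 : ℝ) * (J : ℝ) ^ walshL1Exponent ≤ 16 * (J : ℝ) ^ walshL1Exponent := by
    have : 0 ≤ (J : ℝ) ^ walshL1Exponent := by positivity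
    linarith
  rcases le_or_gt J P with hJP | hJP
  · rw [hIco]
    exact (sum_Ico_norm_walshCoeff_le_rpow A a' J hJ1 hJP).trans hJκ
  · -- `P < J ≤ 4P`: at most four periods
    have hperm : ∀ (m j : ℕ), f (j + P * m) = f j := by
      intro m
      induction m with
      | zero => intro j; simp
      | succ m ih => intro j; rw [Nat.mul_succ, ← add_assoc, hfper, ih]
    have h4 : ∑ j ∈ range J, f (a' + j) ≤ 4 * ∑ k ∈ Ico a' (a' + P), f k := by
      calc ∑ j ∈ range J, f (a' + j) ≤ ∑ j ∈ range (P * 4), f (a' + j) := by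
            refine Finset.sum_le_sum_of_subset_of_nonneg ?_ fun j _ _ => hf0 _
            exact Finset.range_subset_range.2 (by omega)
        _ = ∑ m ∈ range 4, ∑ k ∈ range P, f (a' + (k + P * m)) := sum_range_mul_eq_sum_sum _ P 4
        _ = ∑ _m ∈ range 4, ∑ k ∈ Ico a' (a' + P), f k := by
            refine Finset.sum_congr rfl fun m _ => ?_
            rw [← hIco]
            exact Finset.sum_congr rfl fun k _ => by rw [← add_assoc, hperm]
        _ = 4 * ∑ k ∈ Ico a' (a' + P), f k := by rw [Finset.sum_const, Finset.card_range, nsmul_eq_mul]; norm_num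
    have hPκ : (P : ℝ) ^ walshL1Exponent ≤ (J : ℝ) ^ walshL1Exponent :=
      Real.rpow_le_rpow (Nat.cast_nonneg _) (by exact_mod_cast hJP.le) hκ0
    have hper1 : ∑ k ∈ Ico a' (a' + P), f k ≤ 4 * (P : ℝ) ^ walshL1Exponent :=
      sum_Ico_norm_walshCoeff_le_rpow A a' P Nat.one_le_two_pow le_rfl
    calc ∑ j ∈ range J, f (a' + j) ≤ 4 * ∑ k ∈ Ico a' (a' + P), f k := h4
      _ ≤ 4 * (4 * (P : ℝ) ^ walshL1Exponent) := mul_le_mul_of_nonneg_left hper1 (by norm_num)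
      _ ≤ 16 * (J : ℝ) ^ walshL1Exponent := by nlinarith [hPκ]

/-! ### The Fourier expansion of a differenced product of `W_A` -/

/-- **(2.8)/(2.11) for the localised substitute, with the geometric-sum majorant.** For the
real-valued `W = W_A` of `MoebiusWalshLocalised` (`A ⊆ Fin (q+σ)`, coefficients `Ŵ(k)`,
`|k| < F = 2K₁2^σ`, period `Q = 2^{q+σ}`), every `n ℓ` and every block `[a, b)` of the short
variable,
`|∑_{a ≤ m < b} W(m(n + ℓ2^q)) W(mn)| ≤ ∑_{k,k'} |Ŵ(k)||Ŵ(k')| min(b-a, 1/(2‖((k'-k)n + k'ℓ2^q)/Q‖))`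
(expand `W(mn)` and the complex conjugate of the real number `W(m(n+ℓ2^q))`, sum the geometric
series in `m`). [cite: Bourgain2013MoebiusWalsh, §2 (2.8), (2.11)] -/
theorem abs_sum_Ico_localisedWalshRe_mul_shift_le (q σ K₁ : ℕ) (A : Finset (Fin (q + σ))) (n ℓ a b : ℕ) :
    |∑ m ∈ Ico a b, localisedWalshRe q σ K₁ A (m * (n + ℓ * 2 ^ q)) * localisedWalshRe q σ K₁ A (m * n)| ≤
      ∑ k ∈ Ioo (-((2 * (K₁ * 2 ^ σ) : ℕ) : ℤ)) ((2 * (K₁ * 2 ^ σ) : ℕ) : ℤ),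
        ∑ k' ∈ Ioo (-((2 * (K₁ * 2 ^ σ) : ℕ) : ℤ)) ((2 * (K₁ * 2 ^ σ) : ℕ) : ℤ),
          ‖localisedCoeff q σ K₁ A k‖ * ‖localisedCoeff q σ K₁ A k'‖ *
            geomBound ((b - a : ℕ) : ℝ) ((((k' - k) * n + k' * ℓ * 2 ^ q : ℤ) : ℝ) / 2 ^ (q + σ)) := by
  set 𝓚 : Finset ℤ := Ioo (-((2 * (K₁ * 2 ^ σ) : ℕ) : ℤ)) ((2 * (K₁ * 2 ^ σ) : ℕ) : ℤ) with h𝓚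
  set W : ℕ → ℂ := localisedWalsh q σ K₁ A with hW
  set c : ℤ → ℂ := localisedCoeff q σ K₁ A with hc
  set u : ℕ := n + ℓ * 2 ^ q with hu
  set S := ∑ m ∈ Ico a b, localisedWalshRe q σ K₁ A (m * u) * localisedWalshRe q σ K₁ A (m * n) with hS
  set θ : ℤ → ℤ → ℝ := fun k k' => (((k' : ℝ) * u - (k : ℝ) * n) / 2 ^ (q + σ)) with hθ
  -- expansion of one term
  have hterm : ∀ m : ℕ, W (m * n) * starRingEnd ℂ (W (m * u)) =
      ∑ k ∈ 𝓚, ∑ k' ∈ 𝓚, c k * starRingEnd ℂ (c k') * eChar (θ k k' * m) := by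
    intro m
    have h1 : W (m * n) = ∑ k ∈ 𝓚, c k * eChar (-(k * (((m * n : ℕ) : ℝ) / 2 ^ (q + σ)))) := rfl
    have h2 : starRingEnd ℂ (W (m * u)) = ∑ k' ∈ 𝓚, starRingEnd ℂ (c k') *
        eChar (k' * (((m * u : ℕ) : ℝ) / 2 ^ (q + σ))) := by
      rw [hW]; unfold localisedWalsh
      rw [map_sum]
      refine Finset.sum_congr rfl fun k' _ => ?_
      rw [map_mul, conj_eChar, neg_neg]
    rw [h1, h2, Finset.sum_mul_sum]
    refine Finset.sum_congr rfl fun k _ => Finset.sum_congr rfl fun k' _ => ?_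
    rw [mul_mul_mul_comm, ← eChar_add]
    congr 2
    rw [hθ]; push_cast; ring
  have hSC : (S : ℂ) = ∑ k ∈ 𝓚, ∑ k' ∈ 𝓚, c k * starRingEnd ℂ (c k') * ∑ m ∈ Ico a b, eChar (θ k k' * m) := by
    rw [hS]
    push_cast
    have hm : ∀ m : ℕ, (localisedWalshRe q σ K₁ A (m * u) : ℂ) * (localisedWalshRe q σ K₁ A (m * n) : ℂ) =
        W (m * n) * starRingEnd ℂ (W (m * u)) := by
      intro m
      rw [coe_localisedWalshRe, coe_localisedWalshRe, ← hW, conj_localisedWalsh, mul_comm]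
    rw [Finset.sum_congr rfl fun m _ => hm m, Finset.sum_congr rfl fun m _ => hterm m, Finset.sum_comm]
    refine Finset.sum_congr rfl fun k _ => ?_
    rw [Finset.sum_comm]
    refine Finset.sum_congr rfl fun k' _ => ?_
    rw [Finset.mul_sum]
  have hnorm : |S| = ‖(S : ℂ)‖ := by rw [Complex.norm_real, Real.norm_eq_abs]
  rw [hnorm, hSC]
  refine (norm_sum_le _ _).trans (Finset.sum_le_sum fun k _ => ?_)
  refine (norm_sum_le _ _).trans (Finset.sum_le_sum fun k' _ => ?_)
  rw [norm_mul, norm_mul, RCLike.norm_conj]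
  refine mul_le_mul_of_nonneg_left ?_ (by positivity)
  have hab : Ico a b = Ico a (a + (b - a)) := by
    rcases le_or_gt a b with h1 | h1
    · rw [Nat.add_sub_cancel' h1]
    · rw [Finset.Ico_eq_empty_of_le h1.le, Nat.sub_eq_zero_of_le h1.le, add_zero, Finset.Ico_self]
  rw [hab]
  refine (norm_sum_Ico_eChar_le_geomBound (θ k k') a (b - a)).trans (le_of_eq ?_)
  congr 1
  rw [hθ, hu]; push_cast; ring

/-! ### The high-window count for `W_A` -/

/-- **Bourgain 2013, §2 (2.23)–(2.28) for the localised substitute `W_A`** — `typeII_count_high`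
with the Fourier data of `W_A` (`A ⊆ {q, …, q+σ-1}`, `F = 2K₁2^σ`, `8K₁ ≤ 2^q`): total mass
`A₁ = 2(q+2)2^{κσ}` (Lemma 5 (1.11), tree `sum_norm_walshCoeff_le_of_forall_le`), sup
`A_∞ = 2·2^{-c₂|A|}` (Lemma 2, tree `norm_walshCoeff_le_two_mul_rpow`), window bound `16 J^κ`
(`sum_Ico_int_norm_walshCoeff_le`), `κ = walshL1Exponent`, `c₂ = walshSupExponent`; the shift is
`0 < |ℓ| ≤ L`, the long variable ranges over `N' ≤ 2N - N₀` integers below `2N` with `2^q ≤ N`, and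
`D₀ ≥ 1` is the free threshold of the three regimes. Combined with
`abs_sum_Ico_localisedWalshRe_mul_shift_le` (and the trivial diagonal `k = k'`) this is the analytic
input of the type-II estimate for the shifted windows `K = q ≥ μ - ρ`.
[cite: Bourgain2013MoebiusWalsh, §2 (2.8)–(2.12), (2.23)–(2.28)] -/
theorem typeII_count_high_localised {q σ K₁ : ℕ} (A : Finset (Fin (q + σ))) (hA : ∀ j ∈ A, q ≤ (j : ℕ))
    (hK₁ : 8 * K₁ ≤ 2 ^ q) {M : ℝ} (hM : 0 ≤ M) {N N₀ N' : ℕ} (hN : 2 ^ q ≤ N) (hN' : N₀ + N' ≤ 2 * N)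
    {ℓ : ℤ} (hℓ : ℓ ≠ 0) {L : ℝ} (hℓL : (ℓ.natAbs : ℝ) ≤ L) {D₀ : ℕ} (hD₀ : 1 ≤ D₀) :
    ∑ n ∈ Ico N₀ (N₀ + N'), ∑ k ∈ Ioo (-((2 * (K₁ * 2 ^ σ) : ℕ) : ℤ)) ((2 * (K₁ * 2 ^ σ) : ℕ) : ℤ),
      ∑ k' ∈ (Ioo (-((2 * (K₁ * 2 ^ σ) : ℕ) : ℤ)) ((2 * (K₁ * 2 ^ σ) : ℕ) : ℤ)).erase k,
        ‖localisedCoeff q σ K₁ A k‖ * ‖localisedCoeff q σ K₁ A k'‖ *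
          geomBound M ((((k' - k) * n + k' * ℓ * 2 ^ q : ℤ) : ℝ) / 2 ^ (q + σ)) ≤
      ((q + σ : ℕ) : ℝ) *
        ((2 * ((q : ℝ) + 2) * (2 : ℝ) ^ (walshL1Exponent * σ)) ^ 2 * ((16 * ((2 * (K₁ * 2 ^ σ) : ℕ) : ℝ) * N / 2 ^ (q + σ) + 1) * (2 * M) + 24 * N * (1 + Real.log (2 ^ (q + σ)))) +
        (136 * (16 : ℝ) ^ 2 * (2 * (((2 * (K₁ * 2 ^ σ) : ℕ) : ℝ) * L / 2 ^ σ) + 3) * M * ((2 : ℝ) ^ (q + σ) / (16 * N)) ^ (2 * walshL1Exponent) *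
              ((N : ℝ) / 2 ^ q) ^ walshL1Exponent +
            68 * (16 : ℝ) ^ 2 * (2 * (((2 * (K₁ * 2 ^ σ) : ℕ) : ℝ) * L / 2 ^ σ) + 3) * 2 ^ (q + σ) * (1 + Real.log (2 ^ (q + σ))) *
              (D₀ : ℝ) ^ (2 * walshL1Exponent - 1) * ((N : ℝ) / 2 ^ q) ^ walshL1Exponent +
            8 * (16 : ℝ) * N * (2 * ((q : ℝ) + 2) * (2 : ℝ) ^ (walshL1Exponent * σ)) * ((2 : ℝ) ^ (q + σ) / (16 * N)) ^ walshL1Exponent +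
            16 * (16 : ℝ) ^ 2 * N * (q + σ) * (2 * (((2 * (K₁ * 2 ^ σ) : ℕ) : ℝ) * L / 2 ^ σ) + 3) * ((2 : ℝ) ^ σ) ^ walshL1Exponent *
              ((2 : ℝ) ^ (q + σ) / (16 * N)) ^ (1 - walshL1Exponent) * (D₀ : ℝ) ^ (2 * walshL1Exponent - 1)) +
        (144 * (16 : ℝ) * (2 * (((2 * (K₁ * 2 ^ σ) : ℕ) : ℝ) * L / 2 ^ σ) + 3) * (2 * (2 : ℝ) ^ (-(walshSupExponent * A.card))) * M * (D₀ : ℝ) ^ (1 + walshL1Exponent) * N / 2 ^ q +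
            72 * (16 : ℝ) * (2 * (((2 * (K₁ * 2 ^ σ) : ℕ) : ℝ) * L / 2 ^ σ) + 3) * (2 * (2 : ℝ) ^ (-(walshSupExponent * A.card))) * (1 + Real.log (2 ^ (q + σ))) * (D₀ : ℝ) ^ walshL1Exponent *
              2 ^ (q + σ) * N / 2 ^ q +
            8 * (16 : ℝ) * (D₀ : ℝ) ^ walshL1Exponent * N * (2 * (2 : ℝ) ^ (-(walshSupExponent * A.card))) * (2 * ((2 * (K₁ * 2 ^ σ) : ℕ) : ℝ) / 2 ^ σ + 2) *
              (2 * L * M + 2 ^ σ * (1 + Real.log (2 ^ (q + σ)))))) := by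
  set F : ℕ := 2 * (K₁ * 2 ^ σ) with hF
  set c : ℤ → ℝ := fun k => ‖localisedCoeff q σ K₁ A k‖ with hc
  set f : ℤ → ℝ := fun k => ‖walshCoeff A ((k : ℝ) / 2 ^ (q + σ))‖ with hf
  have hc0 : ∀ k, 0 ≤ c k := fun k => norm_nonneg _
  have hcf : ∀ k, c k ≤ f k := fun k => norm_localisedCoeff_le q σ K₁ A k
  have hf0 : ∀ k, 0 ≤ f k := fun k => norm_nonneg _
  have hFQ : 4 * F ≤ 2 ^ (q + σ) := by
    rw [hF, pow_add]
    calc 4 * (2 * (K₁ * 2 ^ σ)) = (8 * K₁) * 2 ^ σ := by ring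
      _ ≤ 2 ^ q * 2 ^ σ := Nat.mul_le_mul_right _ hK₁
  have hκ0 : 0 ≤ walshL1Exponent := walshL1Exponent_pos.le
  have hκ : walshL1Exponent ≤ 1 / 2 := walshL1Exponent_lt_half.le
  -- sup bound (Lemma 2)
  have hAinf : ∀ k, c k ≤ 2 * (2 : ℝ) ^ (-(walshSupExponent * A.card)) :=
    fun k => (hcf k).trans (norm_walshCoeff_le_two_mul_rpow A _)
  have hA0 : 0 ≤ 2 * (2 : ℝ) ^ (-(walshSupExponent * A.card)) := by positivity
  -- window bound (Lemma 6)
  have hBint : ∀ (a : ℤ) (J : ℕ), 1 ≤ J → J ≤ 4 * 2 ^ (q + σ) →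
      ∑ k ∈ Ico a (a + J), c k ≤ 16 * (J : ℝ) ^ walshL1Exponent :=
    fun a J hJ1 hJ => (Finset.sum_le_sum fun k _ => hcf k).trans (sum_Ico_int_norm_walshCoeff_le A a hJ1 hJ)
  -- total mass (Lemma 5 (1.11)): the window has length `< 2^{q+σ}`, a period of `f`
  have hA₁ : ∑ k ∈ Ioo (-(F : ℤ)) F, c k ≤ 2 * ((q : ℝ) + 2) * (2 : ℝ) ^ (walshL1Exponent * σ) := by
    have hper : ∀ k : ℤ, f (k + (2 ^ (q + σ) : ℕ)) = f k := fun k => norm_walshCoeff_int_add_two_pow A k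
    have hsub : Ioo (-(F : ℤ)) F ⊆ Ico (-(F : ℤ)) (-(F : ℤ) + (2 ^ (q + σ) : ℕ)) := by
      intro k hk
      rw [Finset.mem_Ioo] at hk
      rw [Finset.mem_Ico]
      have : ((4 * F : ℕ) : ℤ) ≤ ((2 ^ (q + σ) : ℕ) : ℤ) := by exact_mod_cast hFQ
      push_cast at this ⊢
      constructor <;> omega
    have h5 := sum_norm_walshCoeff_le_of_forall_le A (Nat.le_add_right q σ) hA
    rw [Nat.add_sub_cancel_left] at h5
    calc ∑ k ∈ Ioo (-(F : ℤ)) F, c k ≤ ∑ k ∈ Ioo (-(F : ℤ)) F, f k := Finset.sum_le_sum fun k _ => hcf k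
      _ ≤ ∑ k ∈ Ico (-(F : ℤ)) (-(F : ℤ) + (2 ^ (q + σ) : ℕ)), f k :=
          Finset.sum_le_sum_of_subset_of_nonneg hsub fun k _ _ => hf0 k
      _ = ∑ k ∈ Ico (0 : ℤ) (0 + (2 ^ (q + σ) : ℕ)), f k := by
          have := sum_Ico_int_eq_of_periodic hper 0 F
          rw [zero_sub] at this
          exact this
      _ = ∑ j ∈ range (2 ^ (q + σ)), ‖walshCoeff A ((j : ℝ) / 2 ^ (q + σ))‖ := by
          rw [sum_Ico_int_eq_sum_range]
          refine Finset.sum_congr rfl fun j _ => ?_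
          rw [hf]; dsimp only; push_cast; ring_nf
      _ ≤ 2 * ((q : ℝ) + 2) * (2 : ℝ) ^ (walshL1Exponent * σ) := h5
  have h := typeII_count_high σ q F hFQ hc0 hκ0 hκ (by norm_num : (0 : ℝ) ≤ 16) hA0 hA₁ hAinf hBint
    hM hN hN' hℓ hℓL hD₀
  rw [hF] at h
  exact h

end Literature.NumberTheory.LFunctions.MoebiusWalsh
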